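import Literature.NumberTheory.Automorphic.UnitaryGroupUnipotentLimitCompactOpen
import Mathlib.Data.Fin.Tuple.Sort
import HarnessLib

/-!
# K2 ∕ E3 «EllipticInputs», 13a road A, J4 (ii)-top: the unipotent radicals of the WITT PARABOLICS of a local unitary group
# `U(J')(F_v) ≤ GL_N(E ⊗_F F_v)` are limits of compact open subgroups — for ANY block labelling

Cell `hodgecm-mathlib` (Track B «K2-LIT»), item h413 = `stmt-HodgeConjecture-24833`; author K2E3-p10 (g2); count-neutral helper for the 13a
line (road A; the DRIVER ★ `K2E3LocalIrrepAdmissibleOfConeInputs` takes `hNl : ∀ i, IsLimitOfCompactOpen ↥(t i).N` for the standard Witt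
parabolic triples, whose radicals are K2-defs1's `wittRadical σ J e S = (unipotentRadicalGL _ (wittBlockOn e S)).comap U.subtype`).
PROOF lane: theorems only (no `def`, no `instance`, no `sorry`).

The tree's ★ `isLimitOfCompactOpen_unipotentRadicalGL F c hc` needs a MONOTONE labelling `c : Fin n → α`; the Witt labelling
`wittBlockOn e S` read through an arbitrary index bijection `e` is not monotone.  Here:

* §1 **`isLimitOfCompactOpen_unipotentRadicalGL_of_linearOrder`** — over a non-archimedean local field `F`, `U_c(F)` is a limit of
  compact open subgroups for EVERY labelling `c : Fin n → α` (reindex along the sorting permutation `Tuple.sort c`, ★ `GLn.reindexEquiv`,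
  ★ `IsLimitOfCompactOpen.of_isClosedEmbedding`, and the monotone case ★).
* §2 **`isLimitOfCompactOpen_comap_unipotentRadicalGL_local`** — for a quadratic extension `E/F` of number fields, a finite place `v`,
  ANY form `J'` over `E_v = Π_{w∣v} E_w` and ANY labelling `c : Fin N → α`: the subgroup
  `(unipotentRadicalGL E_v c).comap (U(c ⊗ 1, J')(F_v)).subtype` of the local unitary group is a limit of compact open subgroups
  (closed embedding into `Π_{w∣v} U_c(E_w)` along ★ `localGLPiEquiv`, §1 in each factor, ★ `IsLimitOfCompactOpen.pi`) — the
  `hNl` binder for every `wittRadical`.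

References: I. N. Bernstein, A. V. Zelevinsky, *Induced representations of reductive p-adic groups I*, Ann. Sci. ÉNS 10 (1977), §1.9
(«`U` is the union of its compact open subgroups»); W. Casselman, *Introduction to the theory of admissible representations of p-adic
reductive groups* (1995), Prop. 1.4.4.
-/

set_option autoImplicit false
set_option linter.dupNamespace false

noncomputable section

namespace Summit.HodgeConjecture.HodgeConjecture.Cruxes.H413.K2E3UnipotentRadicalLimitCompactOpen

open NumberField IsDedekindDomain
open _root_.Topology
open Literature.NumberTheory.Automorphic Literature.NumberTheory.Automorphic.UnitaryGroup
open scoped Matrix MatrixGroups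

/-! ## §1 `U_c(F)` is a limit of compact open subgroups for every labelling `c` -/

section LocalField

variable (F : Type*) [Field F] [ValuativeRel F] [TopologicalSpace F] [IsNonarchimedeanLocalField F]
  {n : ℕ} {α : Type*} [LinearOrder α] (c : Fin n → α)

/-- Reindexing along `e` maps `U_c` into `U_{c ∘ e}`: `(g.submatrix e e)` is block triangular with identity diagonal blocks for `c ∘ e`.
[cite: BernsteinZelevinsky1977, §2.1] -/
theorem reindex_symm_mem_unipotentRadicalGL {R : Type*} [CommRing R] (e : Equiv.Perm (Fin n)) (g : GL (Fin n) R)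
    (hg : g ∈ unipotentRadicalGL R c) :
    Units.mapEquiv (Matrix.reindexRingEquiv R e.symm).toMulEquiv g ∈ unipotentRadicalGL R (c ∘ e) := by
  rw [mem_unipotentRadicalGL_iff_entry] at hg ⊢
  obtain ⟨htri, hdiag⟩ := hg
  have hentry : ∀ i j, ((Units.mapEquiv (Matrix.reindexRingEquiv R e.symm).toMulEquiv g : GL (Fin n) R) : Matrix (Fin n) (Fin n) R) i j =
      (g : Matrix (Fin n) (Fin n) R) (e i) (e j) := fun i j => by
    change (Matrix.reindex e.symm e.symm (g : Matrix (Fin n) (Fin n) R)) i j = _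
    rw [Matrix.reindex_apply, Matrix.submatrix_apply, Equiv.symm_symm]
  refine ⟨fun i j hij => ?_, fun i j hij => ?_⟩
  · rw [hentry]; exact htri hij
  · rw [hentry, hdiag _ _ hij, Matrix.one_apply, Matrix.one_apply]
    simp only [e.apply_eq_iff_eq]

/-- **`U_c(F)` is a limit of compact open subgroups for EVERY block labelling `c : Fin n → α`** over a non-archimedean local field `F`:
reindex along the sorting permutation `e = Tuple.sort c` (`c ∘ e` monotone), a closed embedding `U_c ↪ U_{c∘e}` of topological groups,
and apply the monotone case ★ `isLimitOfCompactOpen_unipotentRadicalGL`. [cite: BernsteinZelevinsky1977, §1.9] -/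
theorem isLimitOfCompactOpen_unipotentRadicalGL_of_linearOrder : IsLimitOfCompactOpen ↥(unipotentRadicalGL F c) := by
  haveI : T2Space F := (Literature.NumberTheory.GaloisRepresentations.IsNonarchimedeanLocalField.isLocalField F).toT2Space
  let e : Equiv.Perm (Fin n) := Tuple.sort c
  have hmono : Monotone (c ∘ e) := Tuple.monotone_sort c
  -- the reindexing homomorphism `U_c →* U_{c ∘ e}`
  let ψ : ↥(unipotentRadicalGL F c) →* ↥(unipotentRadicalGL F (c ∘ e)) :=
    ((Units.mapEquiv (Matrix.reindexRingEquiv F e.symm).toMulEquiv).toMonoidHom.restrict (unipotentRadicalGL F c)).codRestrict _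
      fun g => reindex_symm_mem_unipotentRadicalGL c e g.1 g.2
  have hcomp : IsClosedEmbedding (fun g : ↥(unipotentRadicalGL F c) =>
      (GLn.reindexEquiv (R := F) e.symm) ((g : GL (Fin n) F))) :=
    (GLn.reindexEquiv (R := F) e.symm).toHomeomorph.isClosedEmbedding.comp
      (isClosed_unipotentRadicalGL (R := F) c).isClosedEmbedding_subtypeVal
  have hval : IsClosedEmbedding (fun g : ↥(unipotentRadicalGL F (c ∘ e)) => (g : GL (Fin n) F)) :=
    (isClosed_unipotentRadicalGL (R := F) (c ∘ e)).isClosedEmbedding_subtypeVal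
  have hψ : IsClosedEmbedding ψ := IsClosedEmbedding.of_comp hval.isEmbedding hcomp
  exact IsLimitOfCompactOpen.of_isClosedEmbedding ψ hψ (isLimitOfCompactOpen_unipotentRadicalGL F (c ∘ e) hmono)

end LocalField

/-! ## §2 The radicals of the Witt parabolics of `U(J')(F_v) ≤ GL_N(Π_{w ∣ v} E_w)` -/

section Local

variable {F : Type} [Field F] [NumberField F] (E : Type) [Field E] [NumberField E] [Algebra F E]
  (c : E ≃ₐ[F] E) (N : ℕ) (v : HeightOneSpectrum (𝓞 F)) (J' : Matrix (Fin N) (Fin N) (LocalRing E v))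
  {α : Type*} [LinearOrder α] (b : Fin N → α)

omit [NumberField F] in
/-- The `w`-component of an element of `U_b(E_v) ≤ GL_N(Π_{w∣v} E_w)` lies in `U_b(E_w)` (entrywise, ★ `GLn.coe_piEquiv_apply`).
[cite: BernsteinZelevinsky1977, §2.1] -/
theorem localGLPiEquiv_mem_unipotentRadicalGL (g : GL (Fin N) (LocalRing E v)) (hg : g ∈ unipotentRadicalGL (LocalRing E v) b)
    (w : PlacesOver E v) :
    localGLPiEquiv E N v g w ∈ unipotentRadicalGL (w.1.adicCompletion E) b := by
  rw [mem_unipotentRadicalGL_iff_entry] at hg ⊢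
  obtain ⟨htri, hdiag⟩ := hg
  refine ⟨fun i j hij => ?_, fun i j hij => ?_⟩
  · rw [GLn.coe_piEquiv_apply, Matrix.map_apply, htri hij, map_zero]
  · rw [GLn.coe_piEquiv_apply, Matrix.map_apply, hdiag i j hij, Matrix.one_apply, Matrix.one_apply]
    split_ifs <;> simp

/-- **The radical of a Witt parabolic of the local unitary group is a limit of compact open subgroups**: for ANY form `J'` over
`E_v` and ANY labelling `b : Fin N → α`, the subgroup `(U_b(E_v)).comap (U(c ⊗ 1, J')(F_v)).subtype` of `↥U(c ⊗ 1, J')(F_v)` has the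
property that every compact subset lies in a compact open subgroup (closed embedding into `Π_{w∣v} U_b(E_w)`, §1 factorwise,
★ `IsLimitOfCompactOpen.pi`). [cite: BernsteinZelevinsky1977, §1.9] -/
theorem isLimitOfCompactOpen_comap_unipotentRadicalGL_local :
    IsLimitOfCompactOpen ↥((unipotentRadicalGL (LocalRing E v) b).comap (unitaryGroupOfForm (conjLocal E c v) J').subtype) := by
  set K := (unipotentRadicalGL (LocalRing E v) b).comap (unitaryGroupOfForm (conjLocal E c v) J').subtype with hK
  have hmemK : ∀ x : ↥K, ((x : ↥(unitaryGroupOfForm (conjLocal E c v) J')) : GL (Fin N) (LocalRing E v)) ∈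
      unipotentRadicalGL (LocalRing E v) b := fun x => Subgroup.mem_comap.1 x.2
  -- the componentwise homomorphism `K → Π_w U_b(E_w)`
  let ψ : ↥K →* (∀ w : PlacesOver E v, ↥(unipotentRadicalGL (w.1.adicCompletion E) b)) :=
    { toFun := fun x w =>
        ⟨localGLPiEquiv E N v ((x : ↥(unitaryGroupOfForm (conjLocal E c v) J')) : GL (Fin N) (LocalRing E v)) w,
          localGLPiEquiv_mem_unipotentRadicalGL E N v b _ (hmemK x) w⟩
      map_one' := by
        funext w
        exact Subtype.ext (by simp)
      map_mul' := fun x y => by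
        funext w
        exact Subtype.ext (by simp) }
  haveI : ∀ w : PlacesOver E v, T2Space (w.1.adicCompletion E) := fun w => inferInstance
  have hval : IsClosedEmbedding (fun (f : ∀ w : PlacesOver E v, ↥(unipotentRadicalGL (w.1.adicCompletion E) b)) (w : PlacesOver E v) =>
      ((f w : ↥(unipotentRadicalGL (w.1.adicCompletion E) b)) : GL (Fin N) (w.1.adicCompletion E))) :=
    IsClosedEmbedding.piMap fun w => (isClosed_unipotentRadicalGL (R := w.1.adicCompletion E) b).isClosedEmbedding_subtypeVal
  have hKc : IsClosed (K : Set ↥(unitaryGroupOfForm (conjLocal E c v) J')) :=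
    (isClosed_unipotentRadicalGL (R := LocalRing E v) b).preimage continuous_subtype_val
  have hU : IsClosed (unitaryGroupOfForm (conjLocal E c v) J' : Set (GL (Fin N) (LocalRing E v))) :=
    isClosed_unitaryGroupOfForm (continuous_conjLocal E c v) J'
  have hcomp : IsClosedEmbedding (fun x : ↥K =>
      localGLPiEquiv E N v ((x : ↥(unitaryGroupOfForm (conjLocal E c v) J')) : GL (Fin N) (LocalRing E v))) :=
    (localGLPiEquiv E N v).toHomeomorph.isClosedEmbedding.comp
      (hU.isClosedEmbedding_subtypeVal.comp hKc.isClosedEmbedding_subtypeVal)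
  have hψ : IsClosedEmbedding ψ := IsClosedEmbedding.of_comp hval.isEmbedding hcomp
  exact IsLimitOfCompactOpen.of_isClosedEmbedding ψ hψ
    (IsLimitOfCompactOpen.pi fun w => isLimitOfCompactOpen_unipotentRadicalGL_of_linearOrder (w.1.adicCompletion E) b)

end Local

end Summit.HodgeConjecture.HodgeConjecture.Cruxes.H413.K2E3UnipotentRadicalLimitCompactOpen

end
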